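import Literature.Analysis.FluidPDE.TaoFourierSchur
import Literature.Analysis.FluidPDE.CoordDerivatives
import Literature.Analysis.UnboundedOperators.HeatFlowCalculus
import Mathlib.Analysis.SpecialFunctions.ImproperIntegrals
import Mathlib.MeasureTheory.Integral.Prod
import HarnessLib

/-!
# Tao (2011/2013), proof of Prop. 9.1: time integration of the Fourier majorant of the
# nonlinear Duhamel term

Second file (after `TaoFourierSchur.lean`, `LerayHeatTest.lean`) of the discharge of the named fact
`Literature.Analysis.FluidPDE.tao2011_duhamelNonlinearSpeed_unit` (`TaoBoundedTotalSpeed.lean`): the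
nonlinear part (9.7) of the proof of Tao 2011, Prop. 9.1 (*bounded total speed*, arXiv:1108.1165,
Prop. 52, pp. 27–28: "`‖∫₀ᵗ e^{(t−t')Δ} O(P∇(uu))(t') dt'‖_{L¹_t L^∞_x} ≲ E₀`"). Tao evaluates the
`t`-integral of the frequency-localised heat decay first ("interchanging integrals and evaluating
the `t` integral, this becomes `≲ ∑_N ∫₀ᵀ N⁻¹ ‖P_N O(uu)(t')‖_{L^∞} dt'`", (9.7)) and then runs the
dyadic paraproduct/Schur argument. On the Fourier side, before any dyadic decomposition, the same
two steps read:

* `‖ξ‖ ∫_{t' < t} e^{-4π²(t-t')‖ξ‖²} dt ≤ (4π²)⁻¹ ‖ξ‖⁻¹` (`enorm_mul_lintegral_Ioi_heatSymbol_le`), so that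
  by Tonelli on the triangle `0 < t' < t < T` (`lintegral_Ioo_lintegral_Ioo_le_swap`) the
  space–time majorant
  `M(t) = ∫_{0<t'<t} ∑ⱼₖ ∫ ‖ξ‖ e^{-4π²(t-t')‖ξ‖²} |𝓕(uⱼuₖ)(t',ξ)| dξ dt'`
  of the nonlinear Duhamel term (next file) integrates to
  `∫₀ᵀ M ≤ (4π²)⁻¹ ∑ⱼₖ ∫₀ᵀ ∫ ‖ξ‖⁻¹ |𝓕(uⱼuₖ)(t',ξ)| dξ dt'`;
* the bilinear Fourier–Lebesgue estimate of `TaoFourierSchur.lean`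
  (`lintegral_inv_norm_enorm_fourier_mul_le`: `∫ ‖ξ‖⁻¹|𝓕(fg)| ≤ (S/(2π)²) ‖∇f‖₂‖∇g‖₂`, Tao's
  "Schur's test (or Young's inequality)" conclusion) summed over the components
  (`sum_sum_lintegral_inv_norm_fourier_mul_le`: `∑ⱼₖ ‖∇uⱼ‖₂‖∇uₖ‖₂ ≤ 6 ∫ |∇u|²_F`).

The result is `lintegral_lintegral_speedMajorant_le`:

  `∫₀ᵀ M(t) dt ≤ (6 S/(2π)⁴) ∫₀ᵀ ∫ |∇u|²_F`,

stated for any jointly continuous `U : ℝ → (EuclideanSpace ℝ (Fin 3)) → (EuclideanSpace ℝ (Fin 3))` with smooth `L²` slices (the next file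
applies it to the finite energy classical solution, continuously extended outside `[0, T]`), in
`ℝ≥0∞` (no finiteness hypothesis: a slice of infinite dissipation contributes `⊤` on the right).
Everything here is proved; no definition is introduced (the majorant is written out).

## Mathlib / tree search

Tree: `lintegral_inv_norm_enorm_fourier_mul_le`, `schurConst(_pos)` (`TaoFourierSchur`);
`heatSymbol` (`UnboundedOperators/HeatKernel`), `lintegral_Ioi_comp_sub` (`HeatFlowCalculus`);
coordinates `stdVec`, `sq_opNorm_le_sum_sq_norm_apply_stdVec`, `euclidean_fderiv_apply_comp`,
`contDiff_comp_of_contDiff` (`CoordDerivatives`); `MollifiedLimits.eLpNorm_two_pow_two`. Mathlib: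
`integral_exp_mul_Ioi`, `lintegral_lintegral_swap`, `Measurable.lintegral_prod_right`,
`StronglyMeasurable.integral_prod_right`, `MemLp.integrable_mul`, `frobeniusNormSq_eq_sum` (tree,
`VectorCalculus`). No prior time-integrated form of the majorant (`lean search 'speedMajorant|heatSymbol_sub'`).

## References

* T. Tao, *Localisation and compactness properties of the Navier–Stokes global regularity
  problem*, Anal. PDE 6 (2013) 25–107 = arXiv:1108.1165 (`Tao2011`), §9, proof of Prop. 9.1
  (arXiv Prop. 52), pp. 27–28: (9.7) ("interchanging integrals and evaluating the `t` integral")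
  and the Schur-test conclusion (`∑_N a_N² ≲ E₀`).
-/

noncomputable section

open MeasureTheory Set Function Filter Metric Real
open scoped ENNReal NNReal FourierTransform RealInnerProductSpace ContDiff Topology

namespace Literature.Analysis.FluidPDE

open UnboundedOperators

/-! ## The `t`-integral of the heat symbol -/

section HeatTime

/-- `∫_{(τ,∞)} e^{-(2π)²(t-τ)‖ξ‖²} dt = ((2π)²‖ξ‖²)⁻¹` for `ξ ≠ 0` ("evaluating the `t` integral",
Tao 2011, proof of Prop. 9.1, (9.7)). [cite: Tao2011, Prop. 9.1 (proof, (9.7))] -/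
theorem lintegral_Ioi_heatSymbol_sub {ξ : (EuclideanSpace ℝ (Fin 3))} (hξ : ξ ≠ 0) (τ : ℝ) :
    ∫⁻ t in Ioi τ, ENNReal.ofReal (heatSymbol (t - τ) ξ) =
      ENNReal.ofReal (((2 * π) ^ 2 * ‖ξ‖ ^ 2)⁻¹) := by
  rw [lintegral_Ioi_comp_sub (fun s => ENNReal.ofReal (heatSymbol s ξ)) τ]
  have hb : 0 < (2 * π) ^ 2 * ‖ξ‖ ^ 2 := by
    have : 0 < ‖ξ‖ := norm_pos_iff.2 hξ
    positivity
  have ha : -((2 * π) ^ 2 * ‖ξ‖ ^ 2) < 0 := by linarith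
  have hfun : (fun s : ℝ => ENNReal.ofReal (heatSymbol s ξ)) =
      fun s => ENNReal.ofReal (Real.exp (-((2 * π) ^ 2 * ‖ξ‖ ^ 2) * s)) := by
    funext s
    simp only [heatSymbol]
    congr 2
    ring
  rw [hfun, ← ofReal_integral_eq_lintegral_ofReal (integrableOn_exp_mul_Ioi ha 0)
    (Eventually.of_forall fun s => (Real.exp_pos _).le), integral_exp_mul_Ioi ha 0]
  congr 1
  rw [mul_zero, Real.exp_zero, neg_div_neg_eq, one_div]

/-- **The `t`-integral of the heat symbol, weighted**: for every `ξ` and `τ`,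
`‖ξ‖ ∫_{(τ,∞)} e^{-(2π)²(t-τ)‖ξ‖²} dt ≤ ((2π)²)⁻¹ ‖ξ‖⁻¹` in `ℝ≥0∞` (equality for `ξ ≠ 0`; at
`ξ = 0` the left side is `0`). [cite: Tao2011, Prop. 9.1 (proof, (9.7))] -/
theorem enorm_mul_lintegral_Ioi_heatSymbol_le (ξ : (EuclideanSpace ℝ (Fin 3))) (τ : ℝ) :
    ‖ξ‖ₑ * ∫⁻ t in Ioi τ, ENNReal.ofReal (heatSymbol (t - τ) ξ) ≤
      ENNReal.ofReal (((2 * π) ^ 2)⁻¹) * ‖ξ‖ₑ⁻¹ := by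
  by_cases hξ : ξ = 0
  · subst hξ
    simp
  · rw [lintegral_Ioi_heatSymbol_sub hξ τ]
    have hn : 0 < ‖ξ‖ := norm_pos_iff.2 hξ
    rw [← ofReal_norm, ← ENNReal.ofReal_inv_of_pos hn, ← ENNReal.ofReal_mul (norm_nonneg _),
      ← ENNReal.ofReal_mul (by positivity)]
    refine ENNReal.ofReal_le_ofReal (le_of_eq ?_)
    field_simp

/-- The heat symbol is antitone in time: `heatSymbol (ε + s) ξ ≤ heatSymbol s ξ` for `0 ≤ ε`. [folklore] -/
theorem heatSymbol_add_le {ε : ℝ} (hε : 0 ≤ ε) (s : ℝ) (ξ : (EuclideanSpace ℝ (Fin 3))) :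
    heatSymbol (ε + s) ξ ≤ heatSymbol s ξ := by
  simp only [heatSymbol]
  refine Real.exp_le_exp.2 ?_
  have : 0 ≤ (2 * π) ^ 2 * ε * ‖ξ‖ ^ 2 := by positivity
  nlinarith

end HeatTime

/-! ## Tonelli on the triangle `0 < τ < t < T` -/

section Triangle

/-- **Tonelli on the triangle** `{0 < τ < t < T}`: for a measurable `f : ℝ → ℝ → ℝ≥0∞`,
`∫_{t ∈ (0,T)} ∫_{τ ∈ (0,t)} f t τ ≤ ∫_{τ ∈ (0,T)} ∫_{t ∈ (τ,∞)} f t τ` ("interchanging integrals",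
Tao 2011, proof of Prop. 9.1, (9.7)). [folklore] -/
theorem lintegral_Ioo_lintegral_Ioo_le_swap {f : ℝ → ℝ → ℝ≥0∞} (hf : Measurable (uncurry f))
    (T : ℝ) :
    ∫⁻ t in Ioo 0 T, ∫⁻ τ in Ioo 0 t, f t τ ≤ ∫⁻ τ in Ioo 0 T, ∫⁻ t in Ioi τ, f t τ := by
  set g : ℝ → ℝ → ℝ≥0∞ := fun t τ => (Ioi τ).indicator (fun t' => f t' τ) t with hg
  have hgm : Measurable (uncurry g) := by
    have h : uncurry g = {p : ℝ × ℝ | p.2 < p.1}.indicator (uncurry f) := by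
      funext p
      simp only [hg, uncurry, Set.indicator_apply, mem_Ioi, mem_setOf_eq]
    rw [h]
    exact hf.indicator (measurableSet_lt measurable_snd measurable_fst)
  have hL : EqOn (fun t => ∫⁻ τ in Ioo 0 t, f t τ) (fun t => ∫⁻ τ in Ioo 0 T, g t τ) (Ioo 0 T) := by
    intro t ht
    have hset : Ioo 0 t = Iio t ∩ Ioo 0 T := by
      ext τ
      simp only [mem_Ioo, mem_inter_iff, mem_Iio]
      constructor
      · rintro ⟨h0, hτt⟩
        exact ⟨hτt, h0, hτt.trans ht.2⟩
      · rintro ⟨hτt, h0, -⟩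
        exact ⟨h0, hτt⟩
    simp only
    rw [hset, ← Measure.restrict_restrict measurableSet_Iio, ← lintegral_indicator measurableSet_Iio]
    refine lintegral_congr fun τ => ?_
    simp only [hg, Set.indicator_apply, mem_Ioi, mem_Iio]
  calc ∫⁻ t in Ioo 0 T, ∫⁻ τ in Ioo 0 t, f t τ = ∫⁻ t in Ioo 0 T, ∫⁻ τ in Ioo 0 T, g t τ :=
        setLIntegral_congr_fun measurableSet_Ioo hL
    _ = ∫⁻ τ in Ioo 0 T, ∫⁻ t in Ioo 0 T, g t τ := lintegral_lintegral_swap hgm.aemeasurable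
    _ ≤ ∫⁻ τ in Ioo 0 T, ∫⁻ t in Ioi τ, f t τ := by
        refine lintegral_mono fun τ => ?_
        calc ∫⁻ t in Ioo 0 T, g t τ ≤ ∫⁻ t, g t τ := lintegral_mono' Measure.restrict_le_self le_rfl
          _ = ∫⁻ t in Ioi τ, f t τ := lintegral_indicator measurableSet_Ioi _

end Triangle

/-! ## Components of a vector field on `(EuclideanSpace ℝ (Fin 3))` -/

section Components

/-- Components of an `L²` field are in `L²`. [folklore] -/
theorem memLp_two_apply_comp {v : (EuclideanSpace ℝ (Fin 3)) → (EuclideanSpace ℝ (Fin 3))} (hv : MemLp v 2 volume) (j : Fin 3) :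
    MemLp (fun x => v x j) 2 volume :=
  (EuclideanSpace.proj j : (EuclideanSpace ℝ (Fin 3)) →L[ℝ] ℝ).comp_memLp' hv

/-- Products of components of an `L²` field are integrable. [folklore] -/
theorem integrable_comp_mul_comp {v : (EuclideanSpace ℝ (Fin 3)) → (EuclideanSpace ℝ (Fin 3))} (hv : MemLp v 2 volume) (j k : Fin 3) :
    Integrable (fun x => v x j * v x k) :=
  (memLp_two_apply_comp hv j).integrable_mul (memLp_two_apply_comp hv k)

/-- **`∑ⱼ ‖∇vⱼ(x)‖² ≤ |∇v(x)|²_F`**: the operator norms of the component gradients are dominated by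
the Frobenius norm of the derivative (equality in fact; only `≤` is needed). [folklore] -/
theorem sum_sq_norm_fderiv_comp_le_frobeniusNormSq {v : (EuclideanSpace ℝ (Fin 3)) → (EuclideanSpace ℝ (Fin 3))} {x : (EuclideanSpace ℝ (Fin 3))}
    (hv : DifferentiableAt ℝ v x) :
    ∑ j, ‖fderiv ℝ (fun y => v y j) x‖ ^ 2 ≤ frobeniusNormSq (fderiv ℝ v x) := by
  calc ∑ j, ‖fderiv ℝ (fun y => v y j) x‖ ^ 2
      ≤ ∑ j, ∑ l, ‖fderiv ℝ (fun y => v y j) x (stdVec l)‖ ^ 2 :=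
        Finset.sum_le_sum fun j _ => sq_opNorm_le_sum_sq_norm_apply_stdVec _
    _ = ∑ l, ∑ j, (fderiv ℝ v x (stdVec l) j) ^ 2 := by
        rw [Finset.sum_comm]
        refine Finset.sum_congr rfl fun l _ => Finset.sum_congr rfl fun j _ => ?_
        rw [Real.norm_eq_abs, sq_abs, euclidean_fderiv_apply_comp hv]
    _ = ∑ l, ‖fderiv ℝ v x (stdVec l)‖ ^ 2 := by
        refine Finset.sum_congr rfl fun l _ => ?_
        rw [EuclideanSpace.real_norm_sq_eq]
    _ = frobeniusNormSq (fderiv ℝ v x) := by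
        rw [frobeniusNormSq_eq_sum (EuclideanSpace.basisFun (Fin 3) ℝ)]
        refine Finset.sum_congr rfl fun l _ => ?_
        simp [stdVec]

/-- **`∑ⱼ ‖∇vⱼ‖²_{L²} ≤ ∫ |∇v|²_F`** for a differentiable field. [folklore] -/
theorem sum_eLpNorm_fderiv_comp_sq_le {v : (EuclideanSpace ℝ (Fin 3)) → (EuclideanSpace ℝ (Fin 3))} (hv : Differentiable ℝ v) :
    ∑ j, eLpNorm (fderiv ℝ (fun y => v y j)) 2 volume ^ 2 ≤
      ∫⁻ x, ENNReal.ofReal (frobeniusNormSq (fderiv ℝ v x)) := by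
  have hmeas : ∀ j, Measurable fun x => ‖fderiv ℝ (fun y => v y j) x‖ₑ ^ 2 := fun j =>
    (measurable_fderiv ℝ _).enorm.pow_const 2
  calc ∑ j, eLpNorm (fderiv ℝ (fun y => v y j)) 2 volume ^ 2
      = ∑ j, ∫⁻ x, ‖fderiv ℝ (fun y => v y j) x‖ₑ ^ 2 :=
        Finset.sum_congr rfl fun j _ => MollifiedLimits.eLpNorm_two_pow_two _
    _ = ∫⁻ x, ∑ j, ‖fderiv ℝ (fun y => v y j) x‖ₑ ^ 2 := (lintegral_finsetSum _ fun j _ => hmeas j).symm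
    _ ≤ ∫⁻ x, ENNReal.ofReal (frobeniusNormSq (fderiv ℝ v x)) := lintegral_mono fun x => by
        have h : ∑ j, ‖fderiv ℝ (fun y => v y j) x‖ₑ ^ 2 =
            ENNReal.ofReal (∑ j, ‖fderiv ℝ (fun y => v y j) x‖ ^ 2) := by
          rw [ENNReal.ofReal_sum_of_nonneg fun j _ => sq_nonneg _]
          refine Finset.sum_congr rfl fun j _ => ?_
          rw [← ofReal_norm, ENNReal.ofReal_pow (norm_nonneg _)]
        rw [h]
        exact ENNReal.ofReal_le_ofReal (sum_sq_norm_fderiv_comp_le_frobeniusNormSq (hv x))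

/-- **The bilinear Fourier estimate summed over components** (Tao 2011, proof of Prop. 9.1, the
Schur-test conclusion with `∑_N a_N² ≲ E₀`): for a smooth `L²` field `v` on `(EuclideanSpace ℝ (Fin 3))`,
`∑ⱼₖ ∫ ‖ξ‖⁻¹ |𝓕(vⱼvₖ)(ξ)| dξ ≤ (6 S/(2π)²) ∫ |∇v|²_F`, `S = schurConst` (from
`lintegral_inv_norm_enorm_fourier_mul_le` and `aⱼaₖ ≤ aⱼ² + aₖ²`; a slice of infinite
dissipation makes the right side `⊤`). [cite: Tao2011, Prop. 9.1 (proof, Schur's test)] -/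
theorem sum_sum_lintegral_inv_norm_fourier_mul_le {v : (EuclideanSpace ℝ (Fin 3)) → (EuclideanSpace ℝ (Fin 3))} (hv : ContDiff ℝ ∞ v)
    (hv2 : MemLp v 2 volume) :
    ∑ j, ∑ k, ∫⁻ ξ, ‖ξ‖ₑ⁻¹ * ‖𝓕 (fun x => ((v x j * v x k : ℝ) : ℂ)) ξ‖ₑ ≤
      ENNReal.ofReal (6 * (schurConst / (2 * π) ^ 2)) *
        ∫⁻ x, ENNReal.ofReal (frobeniusNormSq (fderiv ℝ v x)) := by
  set D := ∫⁻ x, ENNReal.ofReal (frobeniusNormSq (fderiv ℝ v x)) with hD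
  set c := ENNReal.ofReal (schurConst / (2 * π) ^ 2) with hc
  have hc6 : ENNReal.ofReal (6 * (schurConst / (2 * π) ^ 2)) = 6 * c := by
    rw [hc, ENNReal.ofReal_mul (by norm_num), ENNReal.ofReal_ofNat]
  rcases eq_or_lt_of_le (le_top : D ≤ ⊤) with hDtop | hDtop
  · rw [hDtop, hc6, ENNReal.mul_top]
    · exact le_top
    · exact mul_ne_zero (by norm_num) (ENNReal.ofReal_pos.2 (by
        have := schurConst_pos; positivity)).ne'
  -- finite dissipation: every component gradient is in `L²`
  set a : Fin 3 → ℝ≥0∞ := fun j => eLpNorm (fderiv ℝ (fun y => v y j)) 2 volume with ha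
  have hdiff : Differentiable ℝ v := hv.differentiable (by simp)
  have hsum : ∑ j, a j ^ 2 ≤ D := sum_eLpNorm_fderiv_comp_sq_le hdiff
  have hafin : ∀ j, a j < ⊤ := by
    intro j
    have h1 : a j ^ 2 ≤ D := (Finset.single_le_sum (f := fun j => a j ^ 2)
      (fun _ _ => zero_le) (Finset.mem_univ j)).trans hsum
    have h2 : a j ^ 2 < ⊤ := h1.trans_lt hDtop
    by_contra htop
    rw [not_lt, top_le_iff] at htop
    rw [htop, ENNReal.top_pow two_ne_zero] at h2
    exact lt_irrefl _ h2
  have hvj : ∀ j, ContDiff ℝ ∞ fun y => v y j := fun j => contDiff_comp_of_contDiff hv j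
  -- `a b ≤ a² + b²` in `ℝ≥0∞` (as in `NSVorticityDifference`)
  have hyoung : ∀ a b : ℝ≥0∞, a * b ≤ a ^ 2 + b ^ 2 := by
    intro a b
    rcases le_total a b with h | h
    · calc a * b ≤ b * b := mul_le_mul' h le_rfl
        _ = b ^ 2 := (sq b).symm
        _ ≤ a ^ 2 + b ^ 2 := le_add_self
    · calc a * b ≤ a * a := mul_le_mul' le_rfl h
        _ = a ^ 2 := (sq a).symm
        _ ≤ a ^ 2 + b ^ 2 := le_self_add
  have hterm : ∀ j k, ∫⁻ ξ, ‖ξ‖ₑ⁻¹ * ‖𝓕 (fun x => ((v x j * v x k : ℝ) : ℂ)) ξ‖ₑ ≤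
      c * (a j ^ 2 + a k ^ 2) := by
    intro j k
    calc ∫⁻ ξ, ‖ξ‖ₑ⁻¹ * ‖𝓕 (fun x => ((v x j * v x k : ℝ) : ℂ)) ξ‖ₑ
        ≤ c * a k * a j := lintegral_inv_norm_enorm_fourier_mul_le (hvj j) (hvj k)
            (memLp_two_apply_comp hv2 j) (memLp_two_apply_comp hv2 k) (hafin j) (hafin k)
      _ = c * (a k * a j) := mul_assoc _ _ _
      _ ≤ c * (a k ^ 2 + a j ^ 2) := mul_le_mul' le_rfl (hyoung _ _)
      _ = c * (a j ^ 2 + a k ^ 2) := by rw [add_comm]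
  calc ∑ j, ∑ k, ∫⁻ ξ, ‖ξ‖ₑ⁻¹ * ‖𝓕 (fun x => ((v x j * v x k : ℝ) : ℂ)) ξ‖ₑ
      ≤ ∑ j, ∑ k, c * (a j ^ 2 + a k ^ 2) :=
        Finset.sum_le_sum fun j _ => Finset.sum_le_sum fun k _ => hterm j k
    _ = c * (6 * ∑ j, a j ^ 2) := by
        simp only [← Finset.mul_sum, Finset.sum_add_distrib, Finset.sum_const, Finset.card_univ,
          Fintype.card_fin, nsmul_eq_mul, Nat.cast_ofNat]
        ring
    _ ≤ c * (6 * D) := by gcongr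
    _ = ENNReal.ofReal (6 * (schurConst / (2 * π) ^ 2)) * D := by rw [hc6]; ring

end Components

/-! ## Joint measurability of the Fourier transform of the products of components -/

section Measurability

/-- For a jointly continuous `U : ℝ → (EuclideanSpace ℝ (Fin 3)) → (EuclideanSpace ℝ (Fin 3))`, the map
`(τ, ξ) ↦ 𝓕(Uⱼ(τ)Uₖ(τ))(ξ)` is measurable (the Fourier integral is a parametric Bochner
integral of a continuous integrand). [folklore] -/
theorem measurable_fourier_comp_mul_comp {U : ℝ → (EuclideanSpace ℝ (Fin 3)) → (EuclideanSpace ℝ (Fin 3))} (hU : Continuous (uncurry U))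
    (j k : Fin 3) :
    Measurable fun p : ℝ × (EuclideanSpace ℝ (Fin 3)) => 𝓕 (fun x => ((U p.1 x j * U p.1 x k : ℝ) : ℂ)) p.2 := by
  set G : ℝ × (EuclideanSpace ℝ (Fin 3)) → (EuclideanSpace ℝ (Fin 3)) → ℂ := fun p x =>
    (𝐞 (-⟪x, p.2⟫) : Circle) • (((U p.1 x j * U p.1 x k : ℝ) : ℂ)) with hG
  have hUc : ∀ i, Continuous fun q : (ℝ × (EuclideanSpace ℝ (Fin 3))) × (EuclideanSpace ℝ (Fin 3)) => U q.1.1 q.2 i := fun i =>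
    (continuous_apply i).comp ((PiLp.continuous_ofLp 2 _).comp
      (hU.comp ((continuous_fst.comp continuous_fst).prodMk continuous_snd)))
  have hGc : Continuous (uncurry G) := by
    have h1 : Continuous fun q : (ℝ × (EuclideanSpace ℝ (Fin 3))) × (EuclideanSpace ℝ (Fin 3)) => (𝐞 (-⟪q.2, q.1.2⟫) : Circle) :=
      Real.continuous_fourierChar.comp ((continuous_snd.inner (continuous_snd.comp continuous_fst)).neg)
    have h2 : Continuous fun q : (ℝ × (EuclideanSpace ℝ (Fin 3))) × (EuclideanSpace ℝ (Fin 3)) => (((U q.1.1 q.2 j * U q.1.1 q.2 k : ℝ) : ℂ)) :=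
      Complex.continuous_ofReal.comp ((hUc j).mul (hUc k))
    exact h1.smul h2
  have hsm : StronglyMeasurable (uncurry G) := hGc.stronglyMeasurable
  have hint : StronglyMeasurable fun p : ℝ × (EuclideanSpace ℝ (Fin 3)) => ∫ x, G p x := hsm.integral_prod_right
  have heq : (fun p : ℝ × (EuclideanSpace ℝ (Fin 3)) => 𝓕 (fun x => ((U p.1 x j * U p.1 x k : ℝ) : ℂ)) p.2) =
      fun p => ∫ x, G p x := by
    funext p
    rw [Real.fourier_eq]
  rw [heq]
  exact hint.measurable

/-- The integrand of the majorant, `(t, τ, ξ) ↦ ‖ξ‖ e^{-4π²(t-τ)‖ξ‖²} |𝓕(UⱼUₖ)(τ,ξ)|`, is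
measurable. [folklore] -/
theorem measurable_speedMajorant_integrand {U : ℝ → (EuclideanSpace ℝ (Fin 3)) → (EuclideanSpace ℝ (Fin 3))} (hU : Continuous (uncurry U))
    (j k : Fin 3) :
    Measurable fun q : (ℝ × ℝ) × (EuclideanSpace ℝ (Fin 3)) => ‖q.2‖ₑ * ENNReal.ofReal (heatSymbol (q.1.1 - q.1.2) q.2) *
      ‖𝓕 (fun x => ((U q.1.2 x j * U q.1.2 x k : ℝ) : ℂ)) q.2‖ₑ := by
  have h1 : Measurable fun q : (ℝ × ℝ) × (EuclideanSpace ℝ (Fin 3)) => ‖q.2‖ₑ := measurable_snd.enorm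
  have h2 : Measurable fun q : (ℝ × ℝ) × (EuclideanSpace ℝ (Fin 3)) => ENNReal.ofReal (heatSymbol (q.1.1 - q.1.2) q.2) := by
    refine ENNReal.measurable_ofReal.comp (Continuous.measurable ?_)
    simp only [heatSymbol]
    fun_prop
  have h3 : Measurable fun q : (ℝ × ℝ) × (EuclideanSpace ℝ (Fin 3)) =>
      ‖𝓕 (fun x => ((U q.1.2 x j * U q.1.2 x k : ℝ) : ℂ)) q.2‖ₑ :=
    ((measurable_fourier_comp_mul_comp hU j k).comp
      ((measurable_snd.comp measurable_fst).prodMk measurable_snd)).enorm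
  exact (h1.mul h2).mul h3

end Measurability

/-! ## The time integral of the majorant -/

section Majorant

/-- **Step 2 of the time integration, one frequency function**: for measurable `Φ ≥ 0` and every
`τ`, `∫_{(τ,∞)} ∫ ‖ξ‖ e^{-4π²(t-τ)‖ξ‖²} Φ(ξ) dξ dt ≤ ((2π)²)⁻¹ ∫ ‖ξ‖⁻¹ Φ(ξ) dξ` (Tonelli and
`enorm_mul_lintegral_Ioi_heatSymbol_le`). [cite: Tao2011, Prop. 9.1 (proof, (9.7))] -/
theorem lintegral_Ioi_lintegral_heatSymbol_mul_le {Φ : (EuclideanSpace ℝ (Fin 3)) → ℝ≥0∞} (hΦ : Measurable Φ) (τ : ℝ) :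
    ∫⁻ t in Ioi τ, ∫⁻ ξ, ‖ξ‖ₑ * ENNReal.ofReal (heatSymbol (t - τ) ξ) * Φ ξ ≤
      ENNReal.ofReal (((2 * π) ^ 2)⁻¹) * ∫⁻ ξ, ‖ξ‖ₑ⁻¹ * Φ ξ := by
  have hhs : Measurable fun q : ℝ × (EuclideanSpace ℝ (Fin 3)) => ENNReal.ofReal (heatSymbol (q.1 - τ) q.2) := by
    refine ENNReal.measurable_ofReal.comp (Continuous.measurable ?_)
    simp only [heatSymbol]
    fun_prop
  have hm : Measurable fun q : ℝ × (EuclideanSpace ℝ (Fin 3)) => ‖q.2‖ₑ * ENNReal.ofReal (heatSymbol (q.1 - τ) q.2) * Φ q.2 :=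
    (measurable_snd.enorm.mul hhs).mul (hΦ.comp measurable_snd)
  calc ∫⁻ t in Ioi τ, ∫⁻ ξ, ‖ξ‖ₑ * ENNReal.ofReal (heatSymbol (t - τ) ξ) * Φ ξ
      = ∫⁻ ξ, ∫⁻ t in Ioi τ, ‖ξ‖ₑ * ENNReal.ofReal (heatSymbol (t - τ) ξ) * Φ ξ :=
        lintegral_lintegral_swap hm.aemeasurable
    _ ≤ ∫⁻ ξ, ENNReal.ofReal (((2 * π) ^ 2)⁻¹) * (‖ξ‖ₑ⁻¹ * Φ ξ) := by
        refine lintegral_mono fun ξ => ?_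
        have hmt : Measurable fun t : ℝ => ENNReal.ofReal (heatSymbol (t - τ) ξ) :=
          hhs.comp (measurable_id.prodMk measurable_const)
        calc ∫⁻ t in Ioi τ, ‖ξ‖ₑ * ENNReal.ofReal (heatSymbol (t - τ) ξ) * Φ ξ
            = ∫⁻ t in Ioi τ, (‖ξ‖ₑ * Φ ξ) * ENNReal.ofReal (heatSymbol (t - τ) ξ) :=
              lintegral_congr fun t => by ring
          _ = (‖ξ‖ₑ * Φ ξ) * ∫⁻ t in Ioi τ, ENNReal.ofReal (heatSymbol (t - τ) ξ) :=
              lintegral_const_mul _ hmt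
          _ = Φ ξ * (‖ξ‖ₑ * ∫⁻ t in Ioi τ, ENNReal.ofReal (heatSymbol (t - τ) ξ)) := by ring
          _ ≤ Φ ξ * (ENNReal.ofReal (((2 * π) ^ 2)⁻¹) * ‖ξ‖ₑ⁻¹) :=
              mul_le_mul' le_rfl (enorm_mul_lintegral_Ioi_heatSymbol_le ξ τ)
          _ = ENNReal.ofReal (((2 * π) ^ 2)⁻¹) * (‖ξ‖ₑ⁻¹ * Φ ξ) := by ring
    _ = ENNReal.ofReal (((2 * π) ^ 2)⁻¹) * ∫⁻ ξ, ‖ξ‖ₑ⁻¹ * Φ ξ :=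
        lintegral_const_mul' _ _ ENNReal.ofReal_ne_top

/-- **Step 2, summed over the components**: for measurable `Φⱼₖ ≥ 0` and every `τ`,
`∫_{(τ,∞)} ∑ⱼₖ ∫ ‖ξ‖ e^{-4π²(t-τ)‖ξ‖²} Φⱼₖ ≤ ((2π)²)⁻¹ ∑ⱼₖ ∫ ‖ξ‖⁻¹ Φⱼₖ`. [cite: Tao2011, Prop. 9.1 (proof, (9.7))] -/
theorem lintegral_Ioi_sum_sum_lintegral_heatSymbol_mul_le {Φ : Fin 3 → Fin 3 → (EuclideanSpace ℝ (Fin 3)) → ℝ≥0∞}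
    (hΦ : ∀ j k, Measurable (Φ j k)) (τ : ℝ) :
    ∫⁻ t in Ioi τ, ∑ j, ∑ k, ∫⁻ ξ, ‖ξ‖ₑ * ENNReal.ofReal (heatSymbol (t - τ) ξ) * Φ j k ξ ≤
      ENNReal.ofReal (((2 * π) ^ 2)⁻¹) * ∑ j, ∑ k, ∫⁻ ξ, ‖ξ‖ₑ⁻¹ * Φ j k ξ := by
  have hm : ∀ j k, Measurable fun t : ℝ =>
      ∫⁻ ξ, ‖ξ‖ₑ * ENNReal.ofReal (heatSymbol (t - τ) ξ) * Φ j k ξ := by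
    intro j k
    have hhs : Measurable fun q : ℝ × (EuclideanSpace ℝ (Fin 3)) => ENNReal.ofReal (heatSymbol (q.1 - τ) q.2) := by
      refine ENNReal.measurable_ofReal.comp (Continuous.measurable ?_)
      simp only [heatSymbol]
      fun_prop
    exact ((measurable_snd.enorm.mul hhs).mul ((hΦ j k).comp measurable_snd)).lintegral_prod_right'
  rw [lintegral_finsetSum _ fun j _ => Finset.measurable_sum _ fun k _ => hm j k, Finset.mul_sum]
  refine Finset.sum_le_sum fun j _ => ?_
  rw [lintegral_finsetSum _ fun k _ => hm j k, Finset.mul_sum]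
  exact Finset.sum_le_sum fun k _ => lintegral_Ioi_lintegral_heatSymbol_mul_le (hΦ j k) τ

/-- **`∫₀ᵀ M(t) dt ≤ (6S/(2π)⁴) ∫₀ᵀ ∫ |∇U|²_F`** — the time integral of the Fourier majorant
`M(t) = ∫_{0<τ<t} ∑ⱼₖ ∫ ‖ξ‖ e^{-4π²(t-τ)‖ξ‖²} |𝓕(UⱼUₖ)(τ,ξ)| dξ dτ` of the nonlinear Duhamel
term (Tao 2011, proof of Prop. 9.1, (9.7) and the Schur-test conclusion: "interchanging integrals
and evaluating the `t` integral … `≲ ∑_N a_N² ≲ E₀`"), for a jointly continuous field `U` with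
smooth `L²` slices on `(0, T)`; `S = schurConst`. PROVED. [cite: Tao2011, Prop. 9.1 (proof, (9.7) and Schur's test)] -/
theorem lintegral_lintegral_speedMajorant_le {U : ℝ → (EuclideanSpace ℝ (Fin 3)) → (EuclideanSpace ℝ (Fin 3))} (hUc : Continuous (uncurry U))
    {T : ℝ} (hUs : ∀ τ ∈ Ioo 0 T, ContDiff ℝ ∞ (U τ))
    (hU2 : ∀ τ ∈ Ioo 0 T, MemLp (U τ) 2 volume) :
    ∫⁻ t in Ioo 0 T, ∫⁻ τ in Ioo 0 t, ∑ j, ∑ k,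
        ∫⁻ ξ, ‖ξ‖ₑ * ENNReal.ofReal (heatSymbol (t - τ) ξ) *
          ‖𝓕 (fun x => ((U τ x j * U τ x k : ℝ) : ℂ)) ξ‖ₑ ≤
      ENNReal.ofReal (6 * schurConst / (2 * π) ^ 4) *
        ∫⁻ τ in Ioo 0 T, ∫⁻ x, ENNReal.ofReal (frobeniusNormSq (fderiv ℝ (U τ) x)) := by
  have hF : ∀ j k, Measurable fun p : ℝ × (EuclideanSpace ℝ (Fin 3)) =>
      𝓕 (fun x => ((U p.1 x j * U p.1 x k : ℝ) : ℂ)) p.2 :=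
    fun j k => measurable_fourier_comp_mul_comp hUc j k
  -- measurability of the `(t, τ)`-integrand of the triangle Tonelli
  have hfm : Measurable (uncurry fun t τ : ℝ => ∑ j, ∑ k,
      ∫⁻ ξ, ‖ξ‖ₑ * ENNReal.ofReal (heatSymbol (t - τ) ξ) *
        ‖𝓕 (fun x => ((U τ x j * U τ x k : ℝ) : ℂ)) ξ‖ₑ) := by
    change Measurable fun p : ℝ × ℝ => ∑ j, ∑ k,
      ∫⁻ ξ, ‖ξ‖ₑ * ENNReal.ofReal (heatSymbol (p.1 - p.2) ξ) *
        ‖𝓕 (fun x => ((U p.2 x j * U p.2 x k : ℝ) : ℂ)) ξ‖ₑ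
    refine Finset.measurable_sum _ fun j _ => Finset.measurable_sum _ fun k _ => ?_
    exact (measurable_speedMajorant_integrand hUc j k).lintegral_prod_right'
  -- the constants
  set c₁ : ℝ≥0∞ := ENNReal.ofReal (((2 * π) ^ 2)⁻¹) with hc₁
  set c₂ : ℝ≥0∞ := ENNReal.ofReal (6 * (schurConst / (2 * π) ^ 2)) with hc₂
  have hconst : c₁ * c₂ = ENNReal.ofReal (6 * schurConst / (2 * π) ^ 4) := by
    rw [hc₁, hc₂, ← ENNReal.ofReal_mul (by positivity)]
    congr 1
    field_simp
  calc ∫⁻ t in Ioo 0 T, ∫⁻ τ in Ioo 0 t, ∑ j, ∑ k,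
        ∫⁻ ξ, ‖ξ‖ₑ * ENNReal.ofReal (heatSymbol (t - τ) ξ) *
          ‖𝓕 (fun x => ((U τ x j * U τ x k : ℝ) : ℂ)) ξ‖ₑ
      ≤ ∫⁻ τ in Ioo 0 T, ∫⁻ t in Ioi τ, ∑ j, ∑ k,
          ∫⁻ ξ, ‖ξ‖ₑ * ENNReal.ofReal (heatSymbol (t - τ) ξ) *
            ‖𝓕 (fun x => ((U τ x j * U τ x k : ℝ) : ℂ)) ξ‖ₑ :=
        lintegral_Ioo_lintegral_Ioo_le_swap hfm T
    _ ≤ ∫⁻ τ in Ioo 0 T, c₁ * ∑ j, ∑ k,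
          ∫⁻ ξ, ‖ξ‖ₑ⁻¹ * ‖𝓕 (fun x => ((U τ x j * U τ x k : ℝ) : ℂ)) ξ‖ₑ := by
        refine lintegral_mono fun τ => ?_
        exact lintegral_Ioi_sum_sum_lintegral_heatSymbol_mul_le
          (Φ := fun j k ξ => ‖𝓕 (fun x => ((U τ x j * U τ x k : ℝ) : ℂ)) ξ‖ₑ)
          (fun j k => ((hF j k).comp (measurable_const.prodMk measurable_id)).enorm) τ
    _ ≤ ∫⁻ τ in Ioo 0 T, c₁ * (c₂ * ∫⁻ x, ENNReal.ofReal (frobeniusNormSq (fderiv ℝ (U τ) x))) := by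
        refine setLIntegral_mono' measurableSet_Ioo fun τ hτ => ?_
        exact mul_le_mul' le_rfl (sum_sum_lintegral_inv_norm_fourier_mul_le (hUs τ hτ) (hU2 τ hτ))
    _ = ENNReal.ofReal (6 * schurConst / (2 * π) ^ 4) *
          ∫⁻ τ in Ioo 0 T, ∫⁻ x, ENNReal.ofReal (frobeniusNormSq (fderiv ℝ (U τ) x)) := by
        rw [← hconst, mul_assoc, ← lintegral_const_mul' _ _ ENNReal.ofReal_ne_top,
          ← lintegral_const_mul' _ _ ENNReal.ofReal_ne_top]

end Majorant

end Literature.Analysis.FluidPDE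

end
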